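/-
Copyright: the b2b-balaban T⁴-continuum CRUX team, row NE7b OWNER lineage `t4-ne7b-p1` (gen 127). Project licence.
-/
import Summits.QuantumFields.BalabanUV.T4Continuum.Spine.NE7b.SupFibreGaussianCovariance
import Literature.Analysis.Matrix.FiniteRangeDecomposition

/-!
# A FINITE-RANGE DECOMPOSITION OF THE FLUCTUATION COVARIANCE, BY NAME: for a LOCAL chart `P` (each chart field `Pe_j` supported
# within radius `r` of a home site) and a form `H` of range `R_H`, the chart precision matrix `M_z = PᵀHP` of (271) has FINITE RANGE
# `2r + R_H` in the induced distance on the chart index set; so the tree's exact algebraic dyadic Fejér decomposition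
# ([BrydgesGuadagniMitter2004]∕[Bauerschmidt2013] form, `Literature/Analysis/Matrix/FiniteRangeDecomposition`) applies to
# `A = (4∕Λ)M_z` (`0 ≤ A ≤ 4` by the ceilings of `H` and `P`), and pushing it through `P` writes (271)'s fluctuation covariance
# `C = PM_z⁻¹Pᵀ` as `Σ_{N<J} Γ_N + Γ_J^{rem}` with every `Γ_N` POSITIVE SEMIDEFINITE of FINITE RANGE `2r + 2(2^N − 1)(2r + R_H)` on the
# field carrier — the conditional (fluctuation) covariance of the road needs NO separate finite-range construction: in chart
# coordinates it is the inverse of a finite-range positive matrix (row NE7b, node U5c; (271) + the tree's FRD BY NAME; [folklore])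

Cell `pub-balaban`, sub-cell `t4`, spine estimate NE7b (`T4WeightBudget.RelWeightBound`; the cell's OWN estimate — NOT PRINTED in
[Bałaban 1983–89], NOT PROVED).  Crux-route work under `Spine/NE7b/` by the row OWNER (`t4-ne7b-p1` gen 127, file (273)) under FREEZE
(0)'s crux-prover clause, on § [NE7bP1-G126-HANDOFF] NEXT (3)(d) — answering `g126/records/SCOPING-d-cluster.md`'s located point «FRD of
the CONDITIONAL covariance needs its own construction (Adams–Kotecký–Müller, Bauerschmidt)» in the negative — at TEA's level (finite
carriers; the torus instance is (109)'s EXPLICIT block chart, which is block-local, and the road's Hessian of range one); NOTHING of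
Bałaban's is named as a Lean object, valued or asserted; no `T4Continuum/Support` leaf typed; no `def`, no notation (the pieces are
displayed `Matrix.of` entries of the tree's `frdPiece`∕`frdRemainder`); zero `sorry`.  Imports (BY NAME): the OWNER's (271)
`…SupFibreGaussianCovariance` (`form_chart_eq`, `chart_transpose_eq`, `chart_posDef`); the tree's `Literature/Analysis/Matrix/
FiniteRangeDecomposition` (`HasFiniteRange`, `frdPiece`, `frdRemainder`, `frd_identity`, `posSemidef_frdPiece`, `posSemidef_frdRemainder`,
`hasFiniteRange_frdPiece`, `hasFiniteRange_frdRemainder` — 0 sorry); Mathlib's `Matrix.PosSemidef.mul_mul_conjTranspose_same`,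
`Matrix.nonsing_inv_mul`.

WHY (located).  The cluster-expansion step (d2) has two known architectures: a single-step decoupling expansion with the exponentially
decaying `C` (Bałaban ∕ Glimm–Jaffe–Spencer), or a finite-range multiscale integration (Brydges–Slade), whose input is `C = Σ_j C_j`
with `C_j ≥ 0` of range `∼ L^j` so that the fluctuation field is a sum of INDEPENDENT finite-range Gaussian fields and the tree's
`LocalPerturbationPolymerGas`∕`LocalPerturbationClusterExpansion` (finite-range dependence ⟹ polymer gas, Kotecký–Preiss, all proved)
apply scale by scale.  The second needs an FRD of the CONDITIONAL covariance, which is not the inverse of a finite-range operator on the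
field carrier (`C = G − GQ′*NQ′G`).  But in the coordinates of a local chart of the fibre it IS: `C = PM_z⁻¹Pᵀ` with `M_z(j,k) =
H(Pe_j)(Pe_k) = 0` as soon as the homes of `j, k` are `> 2r + R_H` apart, and `P` maps a matrix of chart range `S` to a field kernel of
range `2r + S`.  The tree's FRD is exact for every symmetric `0 ≤ A ≤ 4`, so only a scaling by the ceilings is needed.

WHAT IS PROVED ([folklore]; `ι`, `σ` finite; pseudo-distance `dι` (triangle, symmetric, `dι x x = 0`); homes `home : σ → ι`, radius `r`;
`H` of range `R_H` in the bilinear sense; `M_z(j,k) = H(Pe_j)(Pe_k)`; `Λ = Λ_H·q` from the ceilings `H h h ≤ Λ_HΣh²`, `Σ(Pz)² ≤ qΣz²`):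
* §1 **`chart_hasFiniteRange`** (`M_z` has range `2r + R_H` for `dσ(j,k) = dι(home j, home k)`), `chart_dist_triangle`, `chart_dist_self`.
* §2 `chart_form_le` (`zᵀM_zz ≤ ΛΣz²`), **`four_sub_scaled_posSemidef`** (`4·1 − (4∕Λ)M_z ≥ 0`), `scaled_isHermitian`.
* §3 **`inverse_frd`** (for ANY scalar `c` and every `J`: `M_z⁻¹ = c·Σ_{N<J} C_N(cM_z) + M_z⁻¹·R_J(cM_z)` — the tree's `frd_identity` read
  through `M_z⁻¹`, no inverse of the scaled matrix needed).
* §4 `pushforward_eq_mul` (`Γ(D) = P_m D P_mᵀ` with `P_m(x,j) = (Pe_j)_x`), **`pushforward_posSemidef`**, **`pushforward_hasFiniteRange`**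
  (`D` of chart range `S` ⟹ `Γ(D)` of field range `2r + S`), `pushforward_add`, `pushforward_sum`.
* §5 THE END **`fibre_covariance_frd`**: for every `J`, entrywise `C = Σ_{N<J} Γ_N + Γ_J^{rem}` with `Γ_N = Γ((4∕Λ)C_N((4∕Λ)M_z))` POSITIVE
  SEMIDEFINITE of field range `2r + 2(2^N − 1)(2r + R_H)`, and the remainder `Γ_J^{rem} = Γ(M_z⁻¹R_J)` built from the tree's `R_J`, itself
  positive semidefinite of chart range `(2^J − 1)(2r + R_H)`; §6 toy.

HONEST (what this is NOT).  Algebra by name — no estimate of the pieces' SIZE (the single-shell scaling `sup|C_N| = O(2^{−N}·)` is the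
tree's symbol bound + a Riemann sum, not read here); the remainder `M_z⁻¹R_J` is not finite-range (it is the last-scale covariance); the
independence ∕ convolution reading of `C = ΣΓ_N` for the Gaussian field (the tree's `multivariateGaussian_conv_multivariateGaussian`) and the
scale-by-scale polymer gas are the successor's files; the torus instance needs (109)'s chart re-exported WITH its locality clause (it is
the explicit block chart `ζ ↦ (ζ on z ≠ 0, −Σζ at z = 0)`, behind `∃` today); scalar skeleton ((A3), NC-NE7b-α UNRULED); nothing of
Bałaban's asserted.  BY-NAME EFFECT ON THE WALL: NONE.  NE7b NOT PRINTED ∕ NOT PROVED; spine PROVED 0∕9; rung (B)+1 — the programme's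
measures remain FINITE-torus statements; NOT the mass gap, NOT Clay.  HONEST DEPENDENCY: continuum YM on T⁴ ⇐ BetaPertH ∧ nine spine
estimates (0∕9 proved); BetaPertH ⇐ (D1) ∧ (D4) ∧ CAP+tail; G-an2-4 gates asym, D1 and NE2∕3∕4.
-/

set_option autoImplicit false

noncomputable section

namespace Summit.QuantumFields.BalabanUV.T4Continuum.NE7b.SupFibreFiniteRangeDecomposition

open Matrix
open Literature.Analysis.Matrix (HasFiniteRange frdPiece frdRemainder frd_identity posSemidef_frdPiece posSemidef_frdRemainder
  hasFiniteRange_frdPiece hasFiniteRange_frdRemainder)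
open SupFibreGaussianCovariance (form_chart_eq chart_transpose_eq chart_posDef)

variable {ι : Type*} [Fintype ι] {σ : Type} [Fintype σ] [DecidableEq σ]
  {H : (ι → ℝ) →L[ℝ] (ι → ℝ) →L[ℝ] ℝ} {m p ΛH q : ℝ} (P : (σ → ℝ) →L[ℝ] (ι → ℝ))
  {dι : ι → ι → ℕ} {home : σ → ι} {r RH : ℕ}

/-! ## §1. The chart precision matrix has finite range -/

omit [Fintype ι] [Fintype σ] [DecidableEq σ] in
/-- The induced chart distance `dσ(j,k) = dι(home j, home k)` satisfies the triangle inequality. [folklore] -/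
theorem chart_dist_triangle (htri : ∀ x y w, dι x w ≤ dι x y + dι y w) (j k l : σ) :
    dι (home j) (home l) ≤ dι (home j) (home k) + dι (home k) (home l) :=
  htri _ _ _

omit [Fintype ι] [Fintype σ] [DecidableEq σ] in
/-- The induced chart distance vanishes on the diagonal. [folklore] -/
theorem chart_dist_self (hd0 : ∀ x, dι x x = 0) (j : σ) : dι (home j) (home j) = 0 :=
  hd0 _

omit [Fintype ι] [Fintype σ] in
/-- **`M_z` HAS FINITE RANGE `2r + R_H`**: `H` of range `R_H` (bilinear sense), every `Pe_j` supported within `r` of `home j` ⟹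
`M_z(j,k) = H(Pe_j)(Pe_k) = 0` whenever `dι(home j, home k) > r + R_H + r`. [folklore] -/
theorem chart_hasFiniteRange (htri : ∀ x y w, dι x w ≤ dι x y + dι y w) (hsym : ∀ x y, dι x y = dι y x)
    (hHloc : ∀ h k : ι → ℝ, (∀ x y, h x ≠ 0 → k y ≠ 0 → RH < dι x y) → H h k = 0)
    (hPloc : ∀ j x, r < dι (home j) x → P (Pi.single j 1) x = 0)
    (Mz : Matrix σ σ ℝ) (hMz : ∀ j k, Mz j k = H (P (Pi.single j 1)) (P (Pi.single k 1))) :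
    HasFiniteRange (fun j k => dι (home j) (home k)) (r + RH + r) Mz := by
  intro j k hjk
  rw [hMz]
  refine hHloc _ _ fun x y hx hy => ?_
  have h1 : dι (home j) x ≤ r := not_lt.1 fun h => hx (hPloc j x h)
  have h2 : dι y (home k) ≤ r := by rw [hsym]; exact not_lt.1 fun h => hy (hPloc k y h)
  have h3 := htri (home j) x (home k)
  have h4 := htri x y (home k)
  have hjk' : r + RH + r < dι (home j) (home k) := hjk
  omega

/-! ## §2. Scaling into `0 ≤ A ≤ 4` -/

/-- **THE CEILING OF `M_z`**: `H h h ≤ Λ_HΣh²`, `Λ_H ≥ 0`, `Σ(Pz)² ≤ qΣz²` ⟹ `zᵀM_zz ≤ Λ_H·q·Σz²`. [folklore] -/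
theorem chart_form_le (hceil : ∀ h : ι → ℝ, H h h ≤ ΛH * ∑ x, h x ^ 2) (hΛH : 0 ≤ ΛH)
    (hPceil : ∀ z : σ → ℝ, ∑ x, P z x ^ 2 ≤ q * ∑ i, z i ^ 2) (Mz : Matrix σ σ ℝ)
    (hMz : ∀ j k, Mz j k = H (P (Pi.single j 1)) (P (Pi.single k 1))) (z : σ → ℝ) :
    z ⬝ᵥ Mz *ᵥ z ≤ ΛH * q * ∑ i, z i ^ 2 := by
  rw [← form_chart_eq P Mz hMz]
  nlinarith [hceil (P z), mul_le_mul_of_nonneg_left (hPceil z) hΛH]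

omit [Fintype ι] [Fintype σ] in
/-- The scaled matrix `c·M_z` is symmetric (`H` symmetric). [folklore] -/
theorem scaled_isHermitian (hHsym : ∀ h k : ι → ℝ, H h k = H k h) (Mz : Matrix σ σ ℝ)
    (hMz : ∀ j k, Mz j k = H (P (Pi.single j 1)) (P (Pi.single k 1))) (c : ℝ) : (c • Mz).IsHermitian := by
  have hT := chart_transpose_eq P hHsym Mz hMz
  have hH : Mz.IsHermitian := by rw [IsHermitian, conjTranspose_eq_transpose_of_trivial, hT]
  exact hH.smul (IsSelfAdjoint.all _)

/-- **`4·1 − (4∕Λ)M_z ≥ 0`** (Loewner), `Λ = Λ_H·q > 0`: the tree's FRD hypothesis `A ≤ 4` for `A = (4∕Λ)M_z`. [folklore] -/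
theorem four_sub_scaled_posSemidef (hHsym : ∀ h k : ι → ℝ, H h k = H k h)
    (hceil : ∀ h : ι → ℝ, H h h ≤ ΛH * ∑ x, h x ^ 2) (hΛH : 0 < ΛH)
    (hPceil : ∀ z : σ → ℝ, ∑ x, P z x ^ 2 ≤ q * ∑ i, z i ^ 2) (hq : 0 < q) (Mz : Matrix σ σ ℝ)
    (hMz : ∀ j k, Mz j k = H (P (Pi.single j 1)) (P (Pi.single k 1))) :
    ((4 : ℝ) • (1 : Matrix σ σ ℝ) - (4 / (ΛH * q)) • Mz).PosSemidef := by
  refine Matrix.PosSemidef.of_dotProduct_mulVec_nonneg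
    ((Matrix.isHermitian_one.smul (IsSelfAdjoint.all _)).sub (scaled_isHermitian P hHsym Mz hMz _)) fun z => ?_
  rw [star_trivial, sub_mulVec, dotProduct_sub, smul_mulVec, smul_mulVec, one_mulVec, dotProduct_smul, dotProduct_smul,
    smul_eq_mul, smul_eq_mul]
  have h1 := chart_form_le P hceil hΛH.le hPceil Mz hMz z
  have hzz : z ⬝ᵥ z = ∑ i, z i ^ 2 := Finset.sum_congr rfl fun i _ => by ring
  have hΛ : 0 < ΛH * q := mul_pos hΛH hq
  rw [hzz, sub_nonneg, div_mul_eq_mul_div, div_le_iff₀ hΛ]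
  nlinarith [Finset.sum_nonneg fun i (_ : i ∈ Finset.univ) => sq_nonneg (z i)]

/-! ## §3. The decomposition of `M_z⁻¹` -/

/-- **THE FRD OF `M_z⁻¹`, ANY SCALING**: `M_z` positive definite (floor + chart bound) ⟹ for every scalar `c` and every number of scales
`J`, `M_z⁻¹ = c·Σ_{N<J} C_N(cM_z) + M_z⁻¹·R_J(cM_z)` — the tree's exact identity `(cM_z)·ΣC_N + R_J = 1` multiplied by `M_z⁻¹`. [folklore] -/
theorem inverse_frd (hHsym : ∀ h k : ι → ℝ, H h k = H k h) (hfl : ∀ h : ι → ℝ, m * ∑ x, h x ^ 2 ≤ H h h) (hm : 0 < m)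
    (hP : ∀ z : σ → ℝ, p * ∑ i, z i ^ 2 ≤ ∑ x, P z x ^ 2) (hp : 0 < p) (Mz : Matrix σ σ ℝ)
    (hMz : ∀ j k, Mz j k = H (P (Pi.single j 1)) (P (Pi.single k 1))) (c : ℝ) (J : ℕ) :
    Mz⁻¹ = c • ∑ N ∈ Finset.range J, frdPiece (c • Mz) N + Mz⁻¹ * frdRemainder (c • Mz) J := by
  have hdet : IsUnit Mz.det := isUnit_iff_ne_zero.2 (chart_posDef P hHsym hfl hm hP hp Mz hMz).det_pos.ne'
  have h := congrArg (fun M => Mz⁻¹ * M) (frd_identity (c • Mz) J)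
  simp only [mul_add, ← mul_assoc, mul_one] at h
  rw [Matrix.mul_smul, nonsing_inv_mul _ hdet, smul_mul, one_mul] at h
  exact h.symm

/-! ## §4. Pushing a chart matrix forward to the field carrier -/

omit [Fintype ι] in
/-- **THE PUSHFORWARD IS A CONJUGATION**: `Γ(D)(x,y) = Σ_{j,k}(Pe_j)_x D_{jk}(Pe_k)_y` is `P_m D P_mᵀ` with `P_m(x,j) = (Pe_j)_x`. [folklore] -/
theorem pushforward_eq_mul (D : Matrix σ σ ℝ) :
    (Matrix.of fun x y => ∑ j, ∑ k, P (Pi.single j 1) x * D j k * P (Pi.single k 1) y)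
      = (Matrix.of fun x j => P (Pi.single j 1) x) * D * (Matrix.of fun x j => P (Pi.single j 1) x)ᵀ := by
  ext x y
  simp only [of_apply, mul_apply, transpose_apply, Finset.sum_mul]
  rw [Finset.sum_comm]

/-- **THE PUSHFORWARD OF A POSITIVE SEMIDEFINITE CHART MATRIX IS POSITIVE SEMIDEFINITE** on the field carrier. [folklore] -/
theorem pushforward_posSemidef {D : Matrix σ σ ℝ} (hD : D.PosSemidef) :
    (Matrix.of fun x y => ∑ j, ∑ k, P (Pi.single j 1) x * D j k * P (Pi.single k 1) y).PosSemidef := by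
  rw [pushforward_eq_mul P D, ← conjTranspose_eq_transpose_of_trivial]
  exact hD.mul_mul_conjTranspose_same _

omit [Fintype ι] in
/-- **THE PUSHFORWARD ADDS `2r` TO THE RANGE**: `D` of chart range `S`, every `Pe_j` supported within `r` of `home j` ⟹ `Γ(D)` has field
range `r + S + r`. [folklore] -/
theorem pushforward_hasFiniteRange (htri : ∀ x y w, dι x w ≤ dι x y + dι y w) (hsym : ∀ x y, dι x y = dι y x)
    (hPloc : ∀ j x, r < dι (home j) x → P (Pi.single j 1) x = 0) {S : ℕ} {D : Matrix σ σ ℝ}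
    (hD : HasFiniteRange (fun j k => dι (home j) (home k)) S D) :
    HasFiniteRange dι (r + S + r) (Matrix.of fun x y => ∑ j, ∑ k, P (Pi.single j 1) x * D j k * P (Pi.single k 1) y) := by
  intro x y hxy
  rw [of_apply]
  refine Finset.sum_eq_zero fun j _ => Finset.sum_eq_zero fun k _ => ?_
  rcases eq_or_ne (P (Pi.single j 1) x) 0 with hj | hj
  · rw [hj, zero_mul, zero_mul]
  rcases eq_or_ne (P (Pi.single k 1) y) 0 with hk | hk
  · rw [hk, mul_zero]
  rcases eq_or_ne (D j k) 0 with hD0 | hD0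
  · rw [hD0, mul_zero, zero_mul]
  exfalso
  have h1 : dι x (home j) ≤ r := by rw [hsym]; exact not_lt.1 fun h => hj (hPloc j x h)
  have h2 : dι (home k) y ≤ r := not_lt.1 fun h => hk (hPloc k y h)
  have h3 : dι (home j) (home k) ≤ S := not_lt.1 fun h => hD0 (hD j k h)
  have h4 := htri x (home j) y
  have h5 := htri (home j) (home k) y
  omega

omit [Fintype ι] in
/-- The pushforward is additive in the chart matrix. [folklore] -/
theorem pushforward_add (D D' : Matrix σ σ ℝ) (x y : ι) :
    (∑ j, ∑ k, P (Pi.single j 1) x * (D + D') j k * P (Pi.single k 1) y)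
      = (∑ j, ∑ k, P (Pi.single j 1) x * D j k * P (Pi.single k 1) y)
        + ∑ j, ∑ k, P (Pi.single j 1) x * D' j k * P (Pi.single k 1) y := by
  rw [← Finset.sum_add_distrib]
  refine Finset.sum_congr rfl fun j _ => ?_
  rw [← Finset.sum_add_distrib]
  exact Finset.sum_congr rfl fun k _ => by rw [Matrix.add_apply]; ring

omit [Fintype ι] in
/-- The pushforward of a scaled finite sum of chart matrices. [folklore] -/
theorem pushforward_smul_sum {α : Type*} (s : Finset α) (F : α → Matrix σ σ ℝ) (c : ℝ) (x y : ι) :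
    (∑ j, ∑ k, P (Pi.single j 1) x * (c • ∑ a ∈ s, F a) j k * P (Pi.single k 1) y)
      = ∑ a ∈ s, ∑ j, ∑ k, P (Pi.single j 1) x * (c • F a) j k * P (Pi.single k 1) y := by
  simp only [Matrix.smul_apply, Matrix.sum_apply, smul_eq_mul, Finset.mul_sum, Finset.sum_mul]
  symm
  rw [Finset.sum_comm]
  exact Finset.sum_congr rfl fun j _ => Finset.sum_comm

/-! ## §5. THE END: the finite-range decomposition of the fluctuation covariance -/

/-- **HEADLINE — A FINITE-RANGE DECOMPOSITION OF THE FLUCTUATION COVARIANCE.**  `H` symmetric with floor `m > 0` and ceiling `Λ_H > 0`, of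
range `R_H`; chart `P` with bound `p > 0` and ceiling `q > 0`, local with radius `r` about the homes; `dι` a symmetric pseudo-distance;
`M_z(j,k) = H(Pe_j)(Pe_k)`, `A = (4∕(Λ_Hq))M_z`.  Then for every number of scales `J`: (i) (271)'s fluctuation covariance splits ENTRYWISE
as `C(x,y) = Σ_{N<J} Γ_N(x,y) + Γ_J^{rem}(x,y)` with `Γ_N = Γ((4∕(Λ_Hq))C_N(A))` and `Γ_J^{rem} = Γ(M_z⁻¹R_J(A))`; (ii) every `Γ_N` is POSITIVE
SEMIDEFINITE on the field carrier and of FINITE RANGE `r + 2(2^N − 1)(r + R_H + r) + r`; (iii) the tree's remainder `R_J(A)` is positive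
semidefinite and of chart range `(2^J − 1)(r + R_H + r)`. [folklore] -/
theorem fibre_covariance_frd (hHsym : ∀ h k : ι → ℝ, H h k = H k h) (hfl : ∀ h : ι → ℝ, m * ∑ x, h x ^ 2 ≤ H h h) (hm : 0 < m)
    (hceil : ∀ h : ι → ℝ, H h h ≤ ΛH * ∑ x, h x ^ 2) (hΛH : 0 < ΛH)
    (hP : ∀ z : σ → ℝ, p * ∑ i, z i ^ 2 ≤ ∑ x, P z x ^ 2) (hp : 0 < p)
    (hPceil : ∀ z : σ → ℝ, ∑ x, P z x ^ 2 ≤ q * ∑ i, z i ^ 2) (hq : 0 < q)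
    (htri : ∀ x y w, dι x w ≤ dι x y + dι y w) (hsym : ∀ x y, dι x y = dι y x) (hd0 : ∀ x, dι x x = 0)
    (hHloc : ∀ h k : ι → ℝ, (∀ x y, h x ≠ 0 → k y ≠ 0 → RH < dι x y) → H h k = 0)
    (hPloc : ∀ j x, r < dι (home j) x → P (Pi.single j 1) x = 0)
    (Mz : Matrix σ σ ℝ) (hMz : ∀ j k, Mz j k = H (P (Pi.single j 1)) (P (Pi.single k 1))) (J : ℕ) :
    (∀ x y, (∑ j, ∑ k, P (Pi.single j 1) x * Mz⁻¹ j k * P (Pi.single k 1) y)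
        = (∑ N ∈ Finset.range J,
            ∑ j, ∑ k, P (Pi.single j 1) x * ((4 / (ΛH * q)) • frdPiece ((4 / (ΛH * q)) • Mz) N) j k * P (Pi.single k 1) y)
          + ∑ j, ∑ k, P (Pi.single j 1) x * (Mz⁻¹ * frdRemainder ((4 / (ΛH * q)) • Mz) J) j k * P (Pi.single k 1) y) ∧
    (∀ N, (Matrix.of fun x y =>
        ∑ j, ∑ k, P (Pi.single j 1) x * ((4 / (ΛH * q)) • frdPiece ((4 / (ΛH * q)) • Mz) N) j k * P (Pi.single k 1) y).PosSemidef ∧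
      HasFiniteRange dι (r + 2 * (2 ^ N - 1) * (r + RH + r) + r) (Matrix.of fun x y =>
        ∑ j, ∑ k, P (Pi.single j 1) x * ((4 / (ΛH * q)) • frdPiece ((4 / (ΛH * q)) • Mz) N) j k * P (Pi.single k 1) y)) ∧
    (frdRemainder ((4 / (ΛH * q)) • Mz) J).PosSemidef ∧
      HasFiniteRange (fun j k => dι (home j) (home k)) ((2 ^ J - 1) * (r + RH + r)) (frdRemainder ((4 / (ΛH * q)) • Mz) J) := by
  have hAH := scaled_isHermitian P hHsym Mz hMz (4 / (ΛH * q))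
  have hc : (0 : ℝ) ≤ 4 / (ΛH * q) := by positivity
  have hMzR := chart_hasFiniteRange P htri hsym hHloc hPloc Mz hMz
  have hAR : HasFiniteRange (fun j k => dι (home j) (home k)) (r + RH + r) ((4 / (ΛH * q)) • Mz) := hMzR.smul _
  have htriσ : ∀ j k l : σ, dι (home j) (home l) ≤ dι (home j) (home k) + dι (home k) (home l) := chart_dist_triangle htri
  have hd0σ : ∀ j : σ, dι (home j) (home j) = 0 := chart_dist_self hd0
  refine ⟨fun x y => ?_, fun N => ⟨?_, ?_⟩, posSemidef_frdRemainder hAH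
    (four_sub_scaled_posSemidef P hHsym hceil hΛH hPceil hq Mz hMz) J, hasFiniteRange_frdRemainder htriσ hd0σ hAR J⟩
  · -- (i) the entrywise decomposition
    conv_lhs => rw [inverse_frd P hHsym hfl hm hP hp Mz hMz (4 / (ΛH * q)) J]
    rw [pushforward_add P, pushforward_smul_sum P]
  · -- (ii) positivity of the pieces
    exact pushforward_posSemidef P ((posSemidef_frdPiece hAH N).smul hc)
  · -- (ii) finite range of the pieces
    exact pushforward_hasFiniteRange P htri hsym hPloc ((hasFiniteRange_frdPiece htriσ hd0σ hAR N).smul _)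

/-! ## §6. Toy -/

/-- Toy (`ι = σ = Fin 1`, `P = id`, `H h k = h 0·k 0`, trivial distance): the decomposition with `J = 0` scales (empty sum of pieces,
remainder `R_0 = 1`) holds, and `R_0` is positive semidefinite. -/
example : (frdRemainder ((4 / ((1 : ℝ) * 1)) • (Matrix.of fun _ _ : Fin 1 => (1 : ℝ))) 0).PosSemidef := by
  rw [Literature.Analysis.Matrix.frdRemainder_zero]
  exact Matrix.PosSemidef.one

end Summit.QuantumFields.BalabanUV.T4Continuum.NE7b.SupFibreFiniteRangeDecomposition
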